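import Literature.MathematicalPhysics.QuantumLattice.SpinTwistedHubbardTorus
import Literature.MathematicalPhysics.QuantumLattice.LiebFluxPhase
import HarnessLib

/-!
# The vertical cutting plane of the even square torus: halves, reflection, cut bonds

Support file for the proof of Lieb's flux-phase theorem `Lieb1994_fluxPi_torus`
(`LiebFluxPhase.lean`; E. H. Lieb, PRL **73** (1994) 2158). Lieb cuts the lattice "at the two
dashed lines, called `P`" into two half-cylinders that "are required to be mirror images of each
other"; "the usual square lattice with periodic boundary conditions is included" [Lieb1994, p. 2].
For the fermionic torus `FermionTorus 2 L = (ℤ/Lℤ)²` (`L` even) and the plane `P` between the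
columns `L/2 - 1 | L/2` and `L - 1 | 0` this file provides the finite geometry:

* `col x`, `row x` — the two coordinates (as naturals `< L`); `IsLeft L x : col x < L/2` (the left
  half, decidable) and its complement, the right half;
* `reflect x = (L - 1 - x₀, x₁)` — the geometric reflection `R` through `P` (`Fin.rev` on the
  column), an involution exchanging the halves (`isLeft_reflect_iff`), a graph automorphism of the
  nearest-neighbour torus graph (`adj_reflect_iff`), and the bijection `leftEquivRight` it induces;
* the **cut bonds**: a left site `x` and a right site `y` are adjacent iff `x` lies on the boundary
  columns `L/2 - 1` or `0` (`IsBoundary`) and `y = reflect x` (`adj_iff_isBoundary_and_eq_reflect`,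
  `4 ≤ L`) — "a generic left, right image pair cut by `P`" [Lieb1994, p. 3 and Fig. 1].

## References

* [Lieb1994] E. H. Lieb, Phys. Rev. Lett. 73 (1994) 2158, p. 2 (cutting lines `P`, mirror
  halves, periodic boundary conditions), p. 3 and Fig. 1 (left/right image pairs `l, r`).
-/

noncomputable section

namespace Literature.MathematicalPhysics.QuantumLattice

open Matrix Finset HubbardWave0 Literature.Probability.LatticeModels

namespace FermionTorus

variable {L : ℕ}

/-! ### Coordinates -/

/-- The column (coordinate `0`) of a site of the `L × L` torus, as a natural number `< L`.
[folklore] -/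
def col (x : FermionTorus 2 L) : ℕ := (ofLex x 0 : ℕ)

/-- The row (coordinate `1`) of a site of the `L × L` torus. [folklore] -/
def row (x : FermionTorus 2 L) : ℕ := (ofLex x 1 : ℕ)

/-- `col x < L`. [folklore] -/
theorem col_lt (x : FermionTorus 2 L) : col x < L := (ofLex x 0).isLt

/-- `row x < L`. [folklore] -/
theorem row_lt (x : FermionTorus 2 L) : row x < L := (ofLex x 1).isLt

/-- Two sites are equal iff their columns and rows agree. [folklore] -/
theorem ext_iff' {x y : FermionTorus 2 L} : x = y ↔ col x = col y ∧ row x = row y := by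
  constructor
  · rintro rfl; exact ⟨rfl, rfl⟩
  · rintro ⟨h0, h1⟩
    refine (toLex_ofLex x).symm.trans ((congrArg toLex ?_).trans (toLex_ofLex y))
    funext i
    fin_cases i
    · exact Fin.ext h0
    · exact Fin.ext h1

/-! ### The left half -/

/-- **The left half-torus**: the sites in the columns `0, …, L/2 - 1` ("left half-cylinder",
[Lieb1994, p. 2]). [cite: Lieb1994, p. 2] -/
def IsLeft (L : ℕ) (x : FermionTorus 2 L) : Prop := col x < L / 2

/-- Membership in the left half is decidable. [folklore] -/
instance instDecidablePredIsLeft (L : ℕ) : DecidablePred (IsLeft L) := fun x =>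
  inferInstanceAs (Decidable (col x < L / 2))

/-- Unfolding lemma. [folklore] -/
theorem isLeft_iff (x : FermionTorus 2 L) : IsLeft L x ↔ col x < L / 2 := Iff.rfl

/-- **The boundary columns of the left half**: `col x = L/2 - 1` (next to the cut `L/2 - 1 | L/2`)
or `col x = 0` (next to the cut `L - 1 | 0`). [cite: Lieb1994, p. 3 and Fig. 1] -/
def IsBoundary (L : ℕ) (x : FermionTorus 2 L) : Prop := col x + 1 = L / 2 ∨ col x = 0

/-- Membership in the boundary columns is decidable. [folklore] -/
instance instDecidablePredIsBoundary (L : ℕ) : DecidablePred (IsBoundary L) := fun x =>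
  inferInstanceAs (Decidable (col x + 1 = L / 2 ∨ col x = 0))

/-- Unfolding lemma. [folklore] -/
theorem isBoundary_iff (x : FermionTorus 2 L) : IsBoundary L x ↔ col x + 1 = L / 2 ∨ col x = 0 := Iff.rfl

/-! ### The reflection through the vertical plane -/

/-- **The geometric reflection `R` through the cutting plane `P`**: `(x₀, x₁) ↦ (L - 1 - x₀, x₁)`;
it exchanges the columns `L/2 - 1 ↔ L/2` and `0 ↔ L - 1`. [cite: Lieb1994, p. 3 (reflection `R` through `P`)] -/
def reflect (x : FermionTorus 2 L) : FermionTorus 2 L :=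
  toLex (Function.update (ofLex x) 0 (Fin.rev (ofLex x 0)))

/-- The column of the mirror image. [folklore] -/
theorem col_reflect (x : FermionTorus 2 L) : col (reflect x) = L - 1 - col x := by
  simp only [col, reflect, ofLex_toLex, Function.update_self, Fin.val_rev]
  omega

/-- The row of the mirror image. [folklore] -/
theorem row_reflect (x : FermionTorus 2 L) : row (reflect x) = row x := by
  simp [row, reflect]

/-- `R² = 1`. [folklore] -/
theorem reflect_reflect (x : FermionTorus 2 L) : reflect (reflect x) = x := by
  rw [ext_iff', col_reflect, col_reflect, row_reflect, row_reflect]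
  have := col_lt x
  omega

/-- The reflection as a permutation of the sites. [folklore] -/
def reflectEquiv : FermionTorus 2 L ≃ FermionTorus 2 L :=
  Function.Involutive.toPerm reflect reflect_reflect

/-- `reflectEquiv x = reflect x`. [folklore] -/
@[simp] theorem reflectEquiv_apply (x : FermionTorus 2 L) : reflectEquiv x = reflect x := rfl

/-- `reflectEquiv.symm x = reflect x`. [folklore] -/
@[simp] theorem reflectEquiv_symm_apply (x : FermionTorus 2 L) : reflectEquiv.symm x = reflect x := rfl

/-- **The reflection exchanges the two halves** (`L` even). [cite: Lieb1994, p. 2 (mirror images)] -/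
theorem isLeft_reflect_iff (hL : Even L) (x : FermionTorus 2 L) : IsLeft L (reflect x) ↔ ¬IsLeft L x := by
  rw [isLeft_iff, isLeft_iff, col_reflect]
  have := col_lt x
  obtain ⟨k, rfl⟩ := hL
  omega

/-- The bijection between the left and the right half induced by the reflection.
[cite: Lieb1994, p. 3 (left, right image pairs)] -/
def leftEquivRight (hL : Even L) : {x : FermionTorus 2 L // IsLeft L x} ≃ {x : FermionTorus 2 L // ¬IsLeft L x} where
  toFun a := ⟨reflect a.1, (isLeft_reflect_iff hL a.1).not.2 (not_not.2 a.2)⟩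
  invFun b := ⟨reflect b.1, (isLeft_reflect_iff hL b.1).2 b.2⟩
  left_inv a := Subtype.ext (reflect_reflect a.1)
  right_inv b := Subtype.ext (reflect_reflect b.1)

/-- `leftEquivRight a = reflect a`. [folklore] -/
@[simp] theorem leftEquivRight_apply (hL : Even L) (a : {x : FermionTorus 2 L // IsLeft L x}) :
    (leftEquivRight hL a : FermionTorus 2 L) = reflect a.1 := rfl

/-- `(leftEquivRight)⁻¹ b = reflect b`. [folklore] -/
@[simp] theorem leftEquivRight_symm_apply (hL : Even L) (b : {x : FermionTorus 2 L // ¬IsLeft L x}) :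
    ((leftEquivRight hL).symm b : FermionTorus 2 L) = reflect b.1 := rfl

/-- Boundary sites are left sites (`L ≥ 4`). [folklore] -/
theorem IsBoundary.isLeft (h4 : 4 ≤ L) {x : FermionTorus 2 L} (hx : IsBoundary L x) : IsLeft L x := by
  rw [isBoundary_iff] at hx
  rw [isLeft_iff]
  omega

/-- The mirror image of a boundary site is a right site. [folklore] -/
theorem IsBoundary.not_isLeft_reflect (hL : Even L) (h4 : 4 ≤ L) {x : FermionTorus 2 L}
    (hx : IsBoundary L x) : ¬IsLeft L (reflect x) :=
  (isLeft_reflect_iff hL x).not.2 (not_not.2 (hx.isLeft h4))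

/-! ### The reflection and the shifts, through the comparison with `(ZMod L)²` -/

/-- Column of the mirror image in `ZMod L`: `(R x)₀ = -x₀ - 1`. [folklore] -/
theorem toTorusSite_reflect_zero (x : FermionTorus 2 L) :
    toTorusSite (reflect x) 0 = -toTorusSite x 0 - 1 := by
  rw [toTorusSite_apply, toTorusSite_apply]
  simp only [reflect, ofLex_toLex, Function.update_self, Fin.val_rev]
  rw [Nat.cast_sub (show (ofLex x 0 : ℕ) + 1 ≤ L from (ofLex x 0).isLt), ZMod.natCast_self, Nat.cast_add,
    Nat.cast_one]
  ring

/-- Row of the mirror image in `ZMod L`: `(R x)₁ = x₁`. [folklore] -/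
theorem toTorusSite_reflect_one (x : FermionTorus 2 L) :
    toTorusSite (reflect x) 1 = toTorusSite x 1 := by
  rw [toTorusSite_apply, toTorusSite_apply]
  simp [reflect]

section Shifts

variable [NeZero L]

/-- The column of `x + e₀`. [folklore] -/
theorem col_shift_zero (x : FermionTorus 2 L) : col (shift x 0) = (col x + 1 % L) % L := by
  simp only [col, shift, ofLex_toLex, Function.update_self, Fin.val_add, Fin.val_one']

/-- The column of `x + e₁`. [folklore] -/
theorem col_shift_one (x : FermionTorus 2 L) : col (shift x 1) = col x := by
  simp [col, shift]

/-- The column of `x - e₀`. [folklore] -/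
theorem col_unshift_zero (x : FermionTorus 2 L) : col (unshift x 0) = (L - 1 % L + col x) % L := by
  simp only [col, unshift, ofLex_toLex, Function.update_self, Fin.val_sub, Fin.val_one']

/-- The column of `x - e₁`. [folklore] -/
theorem col_unshift_one (x : FermionTorus 2 L) : col (unshift x 1) = col x := by
  simp [col, unshift]

/-- The reflection reverses the horizontal shift: `R(x + e₀) = R x - e₀`. [folklore] -/
theorem reflect_shift_zero (x : FermionTorus 2 L) : reflect (shift x 0) = unshift (reflect x) 0 := by
  apply toTorusSite_injective
  funext i
  fin_cases i
  · show toTorusSite (reflect (shift x 0)) 0 = toTorusSite (unshift (reflect x) 0) 0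
    rw [toTorusSite_reflect_zero, toTorusSite_shift, toTorusSite_unshift, Pi.add_apply, Pi.sub_apply,
      toTorusSite_reflect_zero, Pi.single_eq_same]
    ring
  · show toTorusSite (reflect (shift x 0)) 1 = toTorusSite (unshift (reflect x) 0) 1
    rw [toTorusSite_reflect_one, toTorusSite_shift, toTorusSite_unshift, Pi.add_apply, Pi.sub_apply,
      toTorusSite_reflect_one, Pi.single_eq_of_ne (by decide : (1 : Fin 2) ≠ 0)]
    ring

/-- The reflection preserves the vertical shift: `R(x + e₁) = R x + e₁`. [folklore] -/
theorem reflect_shift_one (x : FermionTorus 2 L) : reflect (shift x 1) = shift (reflect x) 1 := by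
  apply toTorusSite_injective
  funext i
  fin_cases i
  · show toTorusSite (reflect (shift x 1)) 0 = toTorusSite (shift (reflect x) 1) 0
    rw [toTorusSite_reflect_zero, toTorusSite_shift, toTorusSite_shift, Pi.add_apply, Pi.add_apply,
      toTorusSite_reflect_zero, Pi.single_eq_of_ne (by decide : (0 : Fin 2) ≠ 1)]
    ring
  · show toTorusSite (reflect (shift x 1)) 1 = toTorusSite (shift (reflect x) 1) 1
    rw [toTorusSite_reflect_one, toTorusSite_shift, toTorusSite_shift, Pi.add_apply, Pi.add_apply,
      toTorusSite_reflect_one]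

/-- `R(x - e₀) = R x + e₀`. [folklore] -/
theorem reflect_unshift_zero (x : FermionTorus 2 L) : reflect (unshift x 0) = shift (reflect x) 0 := by
  apply toTorusSite_injective
  funext i
  fin_cases i
  · show toTorusSite (reflect (unshift x 0)) 0 = toTorusSite (shift (reflect x) 0) 0
    rw [toTorusSite_reflect_zero, toTorusSite_shift, toTorusSite_unshift, Pi.add_apply, Pi.sub_apply,
      toTorusSite_reflect_zero, Pi.single_eq_same]
    ring
  · show toTorusSite (reflect (unshift x 0)) 1 = toTorusSite (shift (reflect x) 0) 1
    rw [toTorusSite_reflect_one, toTorusSite_shift, toTorusSite_unshift, Pi.add_apply, Pi.sub_apply,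
      toTorusSite_reflect_one, Pi.single_eq_of_ne (by decide : (1 : Fin 2) ≠ 0)]
    ring

/-- `R(x - e₁) = R x - e₁`. [folklore] -/
theorem reflect_unshift_one (x : FermionTorus 2 L) : reflect (unshift x 1) = unshift (reflect x) 1 := by
  apply toTorusSite_injective
  funext i
  fin_cases i
  · show toTorusSite (reflect (unshift x 1)) 0 = toTorusSite (unshift (reflect x) 1) 0
    rw [toTorusSite_reflect_zero, toTorusSite_unshift, toTorusSite_unshift, Pi.sub_apply, Pi.sub_apply,
      toTorusSite_reflect_zero, Pi.single_eq_of_ne (by decide : (0 : Fin 2) ≠ 1)]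
    ring
  · show toTorusSite (reflect (unshift x 1)) 1 = toTorusSite (unshift (reflect x) 1) 1
    rw [toTorusSite_reflect_one, toTorusSite_unshift, toTorusSite_unshift, Pi.sub_apply, Pi.sub_apply,
      toTorusSite_reflect_one]

/-- **The reflection is an automorphism of the nearest-neighbour torus graph** (`L ≥ 2`).
[cite: Lieb1994, p. 2 ("mirror images of each other")] -/
theorem adj_reflect_iff (hL : 2 ≤ L) (x y : FermionTorus 2 L) :
    (fermionTorusGraph 2 L).Adj (reflect x) (reflect y) ↔ (fermionTorusGraph 2 L).Adj x y := by
  have key : ∀ x y : FermionTorus 2 L, (fermionTorusGraph 2 L).Adj x y →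
      (fermionTorusGraph 2 L).Adj (reflect x) (reflect y) := by
    intro x y h
    rcases (adj_iff_shift_or_unshift hL x y).1 h with ⟨μ, rfl⟩ | ⟨μ, rfl⟩
    · fin_cases μ
      · rw [show ((⟨0, by norm_num⟩ : Fin 2)) = 0 from rfl, reflect_shift_zero]
        exact adj_unshift hL _ 0
      · rw [show ((⟨1, by norm_num⟩ : Fin 2)) = 1 from rfl, reflect_shift_one]
        exact adj_shift hL _ 1
    · fin_cases μ
      · rw [show ((⟨0, by norm_num⟩ : Fin 2)) = 0 from rfl, reflect_unshift_zero]
        exact adj_shift hL _ 0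
      · rw [show ((⟨1, by norm_num⟩ : Fin 2)) = 1 from rfl, reflect_unshift_one]
        exact adj_unshift hL _ 1
  refine ⟨fun h => ?_, key x y⟩
  have h' := key _ _ h
  rwa [reflect_reflect, reflect_reflect] at h'

/-- On the boundary column `L/2 - 1` the mirror image is the right neighbour: `R x = x + e₀`.
[cite: Lieb1994, p. 3 (the pair `l, r` cut by `P`)] -/
theorem reflect_eq_shift_of_col (hL : Even L) {x : FermionTorus 2 L} (hx : col x + 1 = L / 2) :
    reflect x = shift x 0 := by
  obtain ⟨k, hk⟩ := hL
  have hcast : (2 : ZMod L) * ((((ofLex x 0 : ℕ) : ZMod L)) + 1) = 0 := by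
    have h1 : (((ofLex x 0 : ℕ) + 1 : ℕ) : ZMod L) = (k : ZMod L) := by
      rw [show (ofLex x 0 : ℕ) + 1 = k by change col x + 1 = k; omega]
    have h2 : ((k + k : ℕ) : ZMod L) = 0 := by rw [← hk, ZMod.natCast_self]
    push_cast at h1 h2
    linear_combination h2 + 2 * h1
  apply toTorusSite_injective
  funext i
  fin_cases i
  · show toTorusSite (reflect x) 0 = toTorusSite (shift x 0) 0
    rw [toTorusSite_reflect_zero, toTorusSite_shift, Pi.add_apply, Pi.single_eq_same, toTorusSite_apply]
    linear_combination -hcast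
  · show toTorusSite (reflect x) 1 = toTorusSite (shift x 0) 1
    rw [toTorusSite_reflect_one, toTorusSite_shift, Pi.add_apply,
      Pi.single_eq_of_ne (by decide : (1 : Fin 2) ≠ 0), add_zero]

/-- On the boundary column `0` the mirror image is the left neighbour across the seam:
`R x = x - e₀`. [cite: Lieb1994, p. 3 (the pair `l, r` cut by `P`)] -/
theorem reflect_eq_unshift_of_col_zero {x : FermionTorus 2 L} (hx : col x = 0) :
    reflect x = unshift x 0 := by
  have h0 : toTorusSite x 0 = 0 := by
    rw [toTorusSite_apply, show (ofLex x 0 : ℕ) = 0 from hx, Nat.cast_zero]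
  apply toTorusSite_injective
  funext i
  fin_cases i
  · show toTorusSite (reflect x) 0 = toTorusSite (unshift x 0) 0
    rw [toTorusSite_reflect_zero, toTorusSite_unshift, Pi.sub_apply, Pi.single_eq_same, h0]
    ring
  · show toTorusSite (reflect x) 1 = toTorusSite (unshift x 0) 1
    rw [toTorusSite_reflect_one, toTorusSite_unshift, Pi.sub_apply,
      Pi.single_eq_of_ne (by decide : (1 : Fin 2) ≠ 0), sub_zero]

/-- **The cut bonds.** For `L` even, `L ≥ 4`, a left site `x` and a right site `y` are nearest
neighbours iff `x` is on a boundary column and `y = R x` is its mirror image.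
[cite: Lieb1994, p. 3 and Fig. 1 (generic left–right pair `l, r` cut by `P`)] -/
theorem adj_iff_isBoundary_and_eq_reflect (hL : Even L) (h4 : 4 ≤ L) {x y : FermionTorus 2 L}
    (hx : IsLeft L x) (hy : ¬IsLeft L y) :
    (fermionTorusGraph 2 L).Adj x y ↔ IsBoundary L x ∧ y = reflect x := by
  have h2 : 2 ≤ L := by omega
  rw [isLeft_iff] at hx hy
  have hcx := col_lt x
  constructor
  · intro h
    rcases (adj_iff_shift_or_unshift h2 x y).1 h with ⟨μ, rfl⟩ | ⟨μ, rfl⟩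
    · fin_cases μ
      · -- `y = x + e₀`
        rw [show ((⟨0, by norm_num⟩ : Fin 2)) = 0 from rfl] at hy ⊢
        rw [col_shift_zero, Nat.mod_eq_of_lt (show 1 < L by omega),
          Nat.mod_eq_of_lt (show col x + 1 < L by omega)] at hy
        have hb : col x + 1 = L / 2 := by omega
        exact ⟨Or.inl hb, (reflect_eq_shift_of_col hL hb).symm⟩
      · -- `y = x + e₁` stays in the same column
        rw [show ((⟨1, by norm_num⟩ : Fin 2)) = 1 from rfl, col_shift_one] at hy
        exact absurd hx hy
    · fin_cases μ
      · -- `y = x - e₀`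
        rw [show ((⟨0, by norm_num⟩ : Fin 2)) = 0 from rfl] at hy ⊢
        rw [col_unshift_zero, Nat.mod_eq_of_lt (show 1 < L by omega)] at hy
        have hb : col x = 0 := by
          by_contra hne
          rw [show L - 1 + col x = (col x - 1) + L by omega, Nat.add_mod_right,
            Nat.mod_eq_of_lt (show col x - 1 < L by omega)] at hy
          omega
        exact ⟨Or.inr hb, (reflect_eq_unshift_of_col_zero hb).symm⟩
      · rw [show ((⟨1, by norm_num⟩ : Fin 2)) = 1 from rfl, col_unshift_one] at hy
        exact absurd hx hy
  · rintro ⟨hb | hb, rfl⟩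
    · rw [reflect_eq_shift_of_col hL hb]
      exact adj_shift h2 x 0
    · rw [reflect_eq_unshift_of_col_zero hb]
      exact adj_unshift h2 x 0

/-- **Summing over the cut bonds.** For a left site `a`, the sum over the right sites adjacent to
`a` has at most the one term `R a`:
`Σ_{b ∈ R} [a ∼ b] f b = [a ∈ boundary] f (R a)`. [cite: Lieb1994, p. 3 (pairs `l, r`)] -/
theorem sum_right_adj_eq (hL : Even L) (h4 : 4 ≤ L) {M : Type*} [AddCommMonoid M]
    (a : {x : FermionTorus 2 L // IsLeft L x}) (f : {x : FermionTorus 2 L // ¬IsLeft L x} → M) :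
    (∑ b : {x : FermionTorus 2 L // ¬IsLeft L x}, if (fermionTorusGraph 2 L).Adj a.1 b.1 then f b else 0) =
      if IsBoundary L a.1 then f (leftEquivRight hL a) else 0 := by
  by_cases hb : IsBoundary L a.1
  · rw [if_pos hb, Finset.sum_eq_single (leftEquivRight hL a)]
    · rw [if_pos ((adj_iff_isBoundary_and_eq_reflect hL h4 a.2 (leftEquivRight hL a).2).2 ⟨hb, rfl⟩)]
    · intro b _ hne
      rw [if_neg]
      intro hadj
      have h := ((adj_iff_isBoundary_and_eq_reflect hL h4 a.2 b.2).1 hadj).2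
      exact hne (Subtype.ext h)
    · exact fun h => absurd (Finset.mem_univ _) h
  · rw [if_neg hb]
    refine Finset.sum_eq_zero fun b _ => ?_
    rw [if_neg]
    intro hadj
    exact hb ((adj_iff_isBoundary_and_eq_reflect hL h4 a.2 b.2).1 hadj).1

/-- The same sum written from the right: `Σ_{b ∈ R} [b ∼ a] f b = [a ∈ boundary] f (R a)`. [folklore] -/
theorem sum_right_adj_eq' (hL : Even L) (h4 : 4 ≤ L) {M : Type*} [AddCommMonoid M]
    (a : {x : FermionTorus 2 L // IsLeft L x}) (f : {x : FermionTorus 2 L // ¬IsLeft L x} → M) :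
    (∑ b : {x : FermionTorus 2 L // ¬IsLeft L x}, if (fermionTorusGraph 2 L).Adj b.1 a.1 then f b else 0) =
      if IsBoundary L a.1 then f (leftEquivRight hL a) else 0 := by
  rw [← sum_right_adj_eq hL h4 a f]
  refine Finset.sum_congr rfl fun b _ => ?_
  simp only [(fermionTorusGraph 2 L).adj_comm]

end Shifts

end FermionTorus

end Literature.MathematicalPhysics.QuantumLattice

end
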